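import Mathlib.FieldTheory.LinearDisjoint
import Literature.NumberTheory.GaloisRepresentations.InducedGaloisRep
import Literature.NumberTheory.GaloisRepresentations.GoodDihedralLocalImage
import HarnessLib

/-!
# Irreducibility of `ρ|_{Γ_{F'}}` for `F'` linearly disjoint from the projective splitting field

Glue for the crux `DyadicOddResidue.DyadicEisensteinFM` (stmt-Langlands-18741), line
`ordinary-seed-propagation` (rev L3).  Pure Galois theory plus rank-two linear algebra (no `p`-adic
Hodge theory, no Clifford theory).  Let `F₀` be a number field, `A` a Hausdorff topological field
and `ρ : Γ_{F₀} → GL₂(A)` continuous, irreducible, and irreducible on `Γ_K` for every quadratic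
`K/F₀` (the skeleton's hypothesis `hnCM`).  Then there is a finite Galois `M/F₀` such that
`ρ|_{Γ_{F'}}` is irreducible for every finite `F'/F₀` with `M ⊗_{F₀} F'` a field (the tree's
rendering of "linearly disjoint from `M`", as in
`ClozelHarrisTaylor2008.exists_solvable_cm_extension_local`; `F'` need not be Galois):
`exists_isGalois_forall_isField_tensor_isIrreducible_restrictField` (base `F₀ : Type`) and
`…_rat` (base `ℚ`, the skeleton's exact shape of `hnCM`).

Proof (stable lines, `forall_mem_center_of_isOpen_normal`): a common eigenvector of an open normal
`N₀ ⊴ Γ_{F₀}` forces `ρ(N₀)` scalar (three `N₀`-stable lines ⟹ scalar; one is excluded by `hirr`;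
two make the stabiliser an index-`2` open subgroup `= Γ_K`, `K = F̄₀^S` quadratic, excluded by
`hnCM`).  So an infinite projective image gives irreducibility over EVERY finite `F'` (`M := F₀`);
a finite one makes `H = ker (Γ_{F₀} → PGL₂(A))` open (closed — `[T2Space A]` — of finite index),
`M := F̄₀^H` finite Galois, and `M ⊗ F'` a field ⟹ `M ∩ e(F') = F₀` ⟹ `res(Γ_{F'}) · H = Γ_{F₀}`
(Krull) ⟹ a `Γ_{F'}`-stable line is `Γ_{F₀}`-stable (`ρ(H)` is scalar), excluded by `hirr`.

References: J.-P. Serre, *Abelian ℓ-adic representations and elliptic curves* (1968), Ch. I §2.1;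
J. Neukirch, *Algebraic Number Theory* (1999), Ch. IV §1 (Krull topology, Galois correspondence);
A. H. Clifford, Ann. of Math. 38 (1937), Thm. 1 (the stable-line argument is its rank-two shadow).
-/

set_option linter.dupNamespace false -- project-wide option; `Summit.Langlands.Langlands` is the mandated namespace

noncomputable section

open scoped MatrixGroups TensorProduct Matrix
open Field
open Literature.NumberTheory.GaloisRepresentations

namespace Summit.Langlands.Langlands.Theorems.DyadicEisensteinFM

variable {A : Type*} [Field A]

/-- **Three pairwise distinct eigenlines force a scalar (dimension two).**  If `a ∈ GL₂(A)` has
eigenvectors `v, w, u` spanning three pairwise distinct lines, then `a` is central: `v, w` is a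
basis, `u = s v + t w` with `s t ≠ 0`, and `a u = γ u = s α v + t β w` gives `α = γ = β`.
[folklore] -/
theorem GL2_mem_center_of_three_eigenvectors {a : GL (Fin 2) A} {v w u : Fin 2 → A}
    (hv : v ≠ 0) (hw : ∀ c : A, c • v ≠ w) (huv : ∀ c : A, c • v ≠ u) (huw : ∀ c : A, c • w ≠ u)
    {α β γ : A} (hav : a.val *ᵥ v = α • v) (haw : a.val *ᵥ w = β • w) (hau : a.val *ᵥ u = γ • u) :
    a ∈ Subgroup.center (GL (Fin 2) A) := by
  have hvw : LinearIndependent A ![v, w] := (LinearIndependent.pair_iff' hv).mpr hw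
  have hspan : Submodule.span A ({v, w} : Set (Fin 2 → A)) = ⊤ := by
    rw [← Matrix.range_cons_cons_empty v w ![]]
    exact hvw.span_eq_top_of_card_eq_finrank (by simp)
  have hb : ∀ x : Fin 2 → A, ∃ s t : A, s • v + t • w = x := fun x =>
    Submodule.mem_span_pair.mp (hspan.ge Submodule.mem_top)
  -- coordinates of `u`
  obtain ⟨s, t, hu⟩ := hb u
  have hs : s ≠ 0 := by rintro rfl; exact huw t (by simpa using hu)
  have ht : t ≠ 0 := by rintro rfl; exact huv s (by simpa using hu)
  have key : (s * (α - γ)) • v + (t * (β - γ)) • w = 0 := by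
    have h1 : a.val *ᵥ u = (s * α) • v + (t * β) • w := by
      rw [← hu, Matrix.mulVec_add, Matrix.mulVec_smul, Matrix.mulVec_smul, hav, haw, smul_smul,
        smul_smul]
    have h2 : a.val *ᵥ u = (s * γ) • v + (t * γ) • w := by
      rw [hau, ← hu, smul_add, smul_smul, smul_smul, mul_comm γ s, mul_comm γ t]
    calc (s * (α - γ)) • v + (t * (β - γ)) • w
        = ((s * α) • v + (t * β) • w) - ((s * γ) • v + (t * γ) • w) := by
          rw [mul_sub, mul_sub, sub_smul, sub_smul]; abel
      _ = 0 := by rw [← h1, ← h2, sub_self]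
  obtain ⟨h4, h5⟩ := LinearIndependent.pair_iff.mp hvw _ _ key
  have hαγ : α = γ := sub_eq_zero.mp ((mul_eq_zero.mp h4).resolve_left hs)
  have hβγ : β = γ := sub_eq_zero.mp ((mul_eq_zero.mp h5).resolve_left ht)
  -- `a` is the scalar `γ`
  have hmat : a.val = γ • (1 : Matrix (Fin 2) (Fin 2) A) := by
    refine Matrix.toLin'.injective (LinearMap.ext fun x => ?_)
    obtain ⟨s', t', rfl⟩ := hb x
    rw [Matrix.toLin'_apply, Matrix.toLin'_apply, Matrix.smul_mulVec, Matrix.one_mulVec,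
      Matrix.mulVec_add, Matrix.mulVec_smul, Matrix.mulVec_smul, hav, haw, hαγ, hβγ, smul_add,
      smul_smul, smul_smul, smul_smul, smul_smul, mul_comm s' γ, mul_comm t' γ]
  rw [GL2.mem_center_iff]
  simp [hmat, Matrix.smul_apply]

/-- **Stable-line dichotomy.**  Let `τ : G → GL₂(A)` have no common eigenvector, `N₀ ⊴ G` normal,
and `v ≠ 0` a common eigenvector of `τ(N₀)`.  Then either the stabiliser of the line `A v` (the
preimage of `eigenvectorStabilizer v`) has index `2` in `G`, or `τ(N₀)` consists of scalars: the
`G`-translates of `A v` are `N₀`-stable lines; three of them make `τ(N₀)` scalar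
(`GL2_mem_center_of_three_eigenvectors`), one is excluded, two give index `2`. [folklore] -/
theorem index_comap_eigenvectorStabilizer_eq_two_or_forall_mem_center {G : Type*} [Group G]
    (τ : G →* GL (Fin 2) A) (hirr : ¬ HasCommonEigenvector τ) (N₀ : Subgroup G) [hN : N₀.Normal]
    {v : Fin 2 → A} (hv : v ≠ 0) (hev : ∀ n ∈ N₀, ∃ c : A, (τ n).val *ᵥ v = c • v) :
    ((eigenvectorStabilizer v hv).comap τ).index = 2 ∨
      ∀ n ∈ N₀, τ n ∈ Subgroup.center (GL (Fin 2) A) := by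
  -- bookkeeping on the matrices `τ g`
  have hmul : ∀ g h : G, (τ (g * h)).val = (τ g).val * (τ h).val := fun g h => by
    rw [map_mul, Matrix.GeneralLinearGroup.coe_mul]
  have hinv : ∀ (g : G) (x : Fin 2 → A), (τ g).val *ᵥ ((τ g⁻¹).val *ᵥ x) = x := fun g x => by
    rw [Matrix.mulVec_mulVec, ← hmul, mul_inv_cancel, map_one, Matrix.GeneralLinearGroup.coe_one,
      Matrix.one_mulVec]
  have hne : ∀ g : G, (τ g).val *ᵥ v ≠ 0 := fun g h0 => hv (by simpa [h0] using (hinv g⁻¹ v).symm)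
  -- translates of `v` are again common eigenvectors of `N₀` (normality)
  have hevR : ∀ g, ∀ n ∈ N₀, ∃ c : A,
      (τ n).val *ᵥ ((τ g).val *ᵥ v) = c • ((τ g).val *ᵥ v) := by
    intro g n hn
    obtain ⟨c, hc⟩ := hev _ (show g⁻¹ * n * g ∈ N₀ by simpa using hN.conj_mem n hn g⁻¹)
    refine ⟨c, ?_⟩
    rw [Matrix.mulVec_mulVec, ← hmul, show n * g = g * (g⁻¹ * n * g) by group, hmul,
      ← Matrix.mulVec_mulVec, hc, Matrix.mulVec_smul]
  set S : Subgroup G := (eigenvectorStabilizer v hv).comap τ with hSdef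
  have hS : ∀ g, g ∈ S ↔ ∃ c : A, (τ g).val *ᵥ v = c • v := fun g => Iff.rfl
  -- `S ≠ ⊤` (else `v` is a common eigenvector of `τ`)
  obtain ⟨g₀, hg₀⟩ : ∃ g₀, g₀ ∉ S := by
    by_contra! hall
    exact hirr ⟨v, hv, fun g => (hS g).mp (hall g)⟩
  have hw : ∀ c : A, c • v ≠ (τ g₀).val *ᵥ v := fun c hc => hg₀ ((hS g₀).mpr ⟨c, hc.symm⟩)
  by_cases hcen : ∀ n ∈ N₀, τ n ∈ Subgroup.center (GL (Fin 2) A)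
  · exact Or.inr hcen
  refine Or.inl ?_
  -- dichotomy: every translate of the line `A v` is `A v` or `A (τ g₀ v)`
  have hdich : ∀ g, g ∈ S ∨ ∃ c : A, (τ g).val *ᵥ v = c • ((τ g₀).val *ᵥ v) := by
    intro g
    by_contra! h
    obtain ⟨hgS, hgw⟩ := h
    refine hcen fun n hn => ?_
    obtain ⟨α, hα⟩ := hev n hn
    obtain ⟨β, hβ⟩ := hevR g₀ n hn
    obtain ⟨γ, hγ⟩ := hevR g n hn
    exact GL2_mem_center_of_three_eigenvectors hv hw
      (fun c hc => hgS ((hS g).mpr ⟨c, hc.symm⟩)) (fun c hc => hgw c hc.symm) hα hβ hγ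
  -- hence `S` has index two
  refine Subgroup.index_eq_two_iff.mpr ⟨g₀, fun b => ?_⟩
  by_cases hb : b ∈ S
  · refine Or.inr ⟨hb, fun hbg => hg₀ ?_⟩
    simpa using S.mul_mem (S.inv_mem hb) hbg
  · refine Or.inl ⟨?_, hb⟩
    rcases hdich b⁻¹ with h | ⟨c, hc⟩
    · exact absurd (S.inv_mem_iff.mp h) hb
    have hc0 : c ≠ 0 := by rintro rfl; exact hne _ (by rwa [zero_smul] at hc)
    refine (hS _).mpr ⟨c⁻¹, ?_⟩
    rw [hmul, ← Matrix.mulVec_mulVec, (eq_inv_smul_iff₀ hc0).mpr hc.symm, Matrix.mulVec_smul,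
      hinv]

section Galois

variable {F₀ : Type} [Field F₀] [NumberField F₀] [TopologicalSpace A] [IsTopologicalRing A]

omit [NumberField F₀] in
/-- Reducibility of a restriction `ρ|_{Γ_K}` (rank two) means: a common eigenvector of
`ρ(res Γ_K)` (`isIrreducible_iff_not_hasCommonEigenvector` along `restrictField`). [folklore] -/
theorem not_isIrreducible_restrictField_iff {K : Type*} [Field K] [Algebra F₀ K]
    (ρ : FramedGaloisRep F₀ A 2) :
    ¬ (ρ.restrictField K).toGaloisRep.IsIrreducible ↔ ∃ v : Fin 2 → A, v ≠ 0 ∧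
      ∀ k : absoluteGaloisGroup K, ∃ c : A, (ρ (absGaloisRestrict F₀ K k)).val *ᵥ v = c • v :=
  (isIrreducible_iff_not_hasCommonEigenvector
    ((ρ.restrictField K : FramedGaloisRep K A 2) :
      absoluteGaloisGroup K →* GL (Fin 2) A)).not.trans not_not

/-- **Key lemma (a stable line of an open normal subgroup forces scalars).**  Let
`ρ : Γ_{F₀} → GL₂(A)` be irreducible and irreducible on `Γ_K` for every quadratic `K/F₀`.  If an
open normal subgroup `N₀ ⊴ Γ_{F₀}` has a common eigenvector `v`, then `ρ(N₀)` is scalar: otherwise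
the stabiliser `S ⊇ N₀` of the line `A v` has index `2`, is open and normal, and `res(Γ_K) = S`
for the quadratic field `K = F̄₀^S` (`exists_mem_range_absGaloisRestrict_fixedField_iff`,
`finrank_fixedField_of_isOpen`), so `v` is a common eigenvector of `ρ|_{Γ_K}`. [folklore] -/
theorem forall_mem_center_of_isOpen_normal (ρ : FramedGaloisRep F₀ A 2)
    (hirr : ρ.toGaloisRep.IsIrreducible)
    (hnCM : ∀ (K : Type) [Field K] [NumberField K] [Algebra F₀ K], Module.finrank F₀ K = 2 →
      (ρ.restrictField K).toGaloisRep.IsIrreducible)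
    (N₀ : Subgroup (absoluteGaloisGroup F₀)) [N₀.Normal]
    (hN₀ : IsOpen (N₀ : Set (absoluteGaloisGroup F₀))) {v : Fin 2 → A} (hv : v ≠ 0)
    (hev : ∀ n ∈ N₀, ∃ c : A, (ρ n).val *ᵥ v = c • v) :
    ∀ n ∈ N₀, ρ n ∈ Subgroup.center (GL (Fin 2) A) := by
  refine (index_comap_eigenvectorStabilizer_eq_two_or_forall_mem_center
    (ρ : absoluteGaloisGroup F₀ →* GL (Fin 2) A) (not_hasCommonEigenvector_of_isIrreducible _ hirr)
    N₀ hv hev).resolve_left fun hS2 => ?_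
  set S : Subgroup (absoluteGaloisGroup F₀) :=
    (eigenvectorStabilizer v hv).comap (ρ : absoluteGaloisGroup F₀ →* GL (Fin 2) A) with hSdef
  have hS : ∀ g, g ∈ S ↔ ∃ c : A, (ρ g).val *ᵥ v = c • v := fun g => Iff.rfl
  have hN₀S : N₀ ≤ S := fun n hn => (hS n).mpr (hev n hn)
  haveI hSn : S.Normal := Subgroup.normal_of_index_eq_two hS2
  have hSopen : IsOpen (S : Set (absoluteGaloisGroup F₀)) := Subgroup.isOpen_mono hN₀S hN₀
  -- the quadratic field cut out by `S`
  let K : IntermediateField F₀ (AlgebraicClosure F₀) := IntermediateField.fixedField S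
  haveI : FiniteDimensional F₀ K := finiteDimensional_fixedField_of_isOpen S hSopen
  haveI : NumberField K := NumberField.of_module_finite F₀ K
  have hK2 : Module.finrank F₀ K = 2 := (finrank_fixedField_of_isOpen S hSopen).trans hS2
  obtain ⟨g, hg⟩ := exists_mem_range_absGaloisRestrict_fixedField_iff S hSopen
  refine (not_isIrreducible_restrictField_iff (K := K) ρ).mpr ?_ (hnCM K hK2)
  refine ⟨v, hv, fun k => (hS _).mp ?_⟩
  have := hSn.conj_mem _ ((hg _).mp ⟨k, rfl⟩ : g⁻¹ * absGaloisRestrict F₀ K k * g ∈ S) g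
  rwa [show g * (g⁻¹ * absGaloisRestrict F₀ K k * g) * g⁻¹ = absGaloisRestrict F₀ K k by group]
    at this

/-- **Infinite projective image ⟹ `ρ|_{Γ_{F'}}` irreducible for every finite `F'/F₀`** (under
`hirr`, `hnCM`).  A `Γ_{F'}`-stable line is stable under the normal core `N₀` of `res(Γ_{F'})`,
which is open (closed of finite index); by `forall_mem_center_of_isOpen_normal` `ρ(N₀)` is then
scalar, so `ker (Γ_{F₀} → PGL₂(A))` has finite index, i.e. the projective image is finite.
[folklore] -/
theorem isIrreducible_restrictField_of_infinite_projectiveImage (ρ : FramedGaloisRep F₀ A 2)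
    (hirr : ρ.toGaloisRep.IsIrreducible)
    (hnCM : ∀ (K : Type) [Field K] [NumberField K] [Algebra F₀ K], Module.finrank F₀ K = 2 →
      (ρ.restrictField K).toGaloisRep.IsIrreducible)
    (hinf : ¬ Finite (projectiveImage (ρ : absoluteGaloisGroup F₀ →* GL (Fin 2) A)))
    (F' : Type*) [Field F'] [Algebra F₀ F'] [FiniteDimensional F₀ F'] :
    (ρ.restrictField F').toGaloisRep.IsIrreducible := by
  by_contra hred
  obtain ⟨v, hv, hev⟩ := (not_isIrreducible_restrictField_iff ρ).mp hred
  haveI : CharZero F' := charZero_of_injective_algebraMap (algebraMap F₀ F').injective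
  set N : Subgroup (absoluteGaloisGroup F₀) := (absGaloisRestrict F₀ F').range with hNdef
  have hNcl : IsClosed (N : Set (absoluteGaloisGroup F₀)) :=
    isClosed_range_absGaloisRestrict F₀ F'
  haveI : N.FiniteIndex :=
    ⟨(nat_card_quotient_range_absGaloisRestrict F₀ F').trans_ne Module.finrank_pos.ne'⟩
  haveI : N.normalCore.Normal := Subgroup.normalCore_normal N
  have hN₀open : IsOpen (N.normalCore : Set (absoluteGaloisGroup F₀)) :=
    N.normalCore.isOpen_of_isClosed_of_finiteIndex (N.normalCore_isClosed hNcl)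
  have hev₀ : ∀ n ∈ N.normalCore, ∃ c : A, (ρ n).val *ᵥ v = c • v := by
    intro n hn
    obtain ⟨k, rfl⟩ := N.normalCore_le hn
    exact hev k
  have hcen := forall_mem_center_of_isOpen_normal ρ hirr hnCM N.normalCore hN₀open hv hev₀
  -- `N₀ ≤ ker (Γ → PGL₂)`, so the projective image is finite
  set q := Matrix.ProjGenLinGroup.mk.comp (ρ : absoluteGaloisGroup F₀ →* GL (Fin 2) A) with hq
  have hle : N.normalCore ≤ q.ker := fun n hn => by
    rw [MonoidHom.mem_ker, hq, MonoidHom.comp_apply, Matrix.ProjGenLinGroup.mk_eq_one]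
    exact hcen n hn
  exact hinf (Nat.finite_of_card_ne_zero
    (Subgroup.index_ker q ▸ (Subgroup.finiteIndex_of_le hle).index_ne_zero))

variable [T2Space A]

omit [NumberField F₀] [IsTopologicalRing A] in
/-- Over a Hausdorff topological field the kernel of `Γ_{F₀} → GL₂(A) → PGL₂(A)` is closed: it is
cut out by the closed conditions `a₀₁ = 0`, `a₁₀ = 0`, `a₀₀ = a₁₁` on the continuous matrix
`ρ(γ)`. [folklore] -/
theorem isClosed_ker_projective (ρ : FramedGaloisRep F₀ A 2) :
    IsClosed ((Matrix.ProjGenLinGroup.mk.comp (ρ : absoluteGaloisGroup F₀ →* GL (Fin 2) A)).ker :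
      Set (absoluteGaloisGroup F₀)) := by
  have hc : Continuous fun γ : absoluteGaloisGroup F₀ => (ρ γ).val := Units.continuous_val.comp ρ.2
  have hset : ((Matrix.ProjGenLinGroup.mk.comp (ρ : absoluteGaloisGroup F₀ →* GL (Fin 2) A)).ker :
      Set (absoluteGaloisGroup F₀)) = ({γ | (ρ γ).val 0 1 = 0} ∩ {γ | (ρ γ).val 1 0 = 0}) ∩
        {γ | (ρ γ).val 0 0 = (ρ γ).val 1 1} := by
    ext γ
    simp only [SetLike.mem_coe, MonoidHom.mem_ker, MonoidHom.coe_comp, Function.comp_apply,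
      Matrix.ProjGenLinGroup.mk_eq_one, GL2.mem_center_iff, Set.mem_inter_iff, Set.mem_setOf_eq,
      MonoidHom.coe_coe, and_assoc]
  rw [hset]
  exact ((isClosed_eq (hc.matrix_elem 0 1) continuous_const).inter
    (isClosed_eq (hc.matrix_elem 1 0) continuous_const)).inter
    (isClosed_eq (hc.matrix_elem 0 0) (hc.matrix_elem 1 1))

variable (ρ : FramedGaloisRep F₀ A 2)
  [hfin : Finite (projectiveImage (ρ : absoluteGaloisGroup F₀ →* GL (Fin 2) A))]

omit [NumberField F₀] [IsTopologicalRing A] in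
/-- If the projective image is finite, the kernel of `Γ_{F₀} → PGL₂(A)` is open (closed of finite
index). [folklore] -/
theorem isOpen_ker_projective :
    IsOpen ((Matrix.ProjGenLinGroup.mk.comp (ρ : absoluteGaloisGroup F₀ →* GL (Fin 2) A)).ker :
      Set (absoluteGaloisGroup F₀)) := by
  set q := Matrix.ProjGenLinGroup.mk.comp (ρ : absoluteGaloisGroup F₀ →* GL (Fin 2) A) with hq
  haveI : Finite q.range := hfin
  haveI : q.ker.FiniteIndex := ⟨by rw [Subgroup.index_ker]; exact Nat.card_pos.ne'⟩
  exact Subgroup.isOpen_of_isClosed_of_finiteIndex _ (isClosed_ker_projective ρ)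

omit [IsTopologicalRing A] in
/-- The projective splitting field `F̄₀^H`, `H = ker (Γ_{F₀} → PGL₂(A))`, is a finite extension of
`F₀` when the projective image is finite. [folklore] -/
theorem finiteDimensional_fixedField_ker_projective : FiniteDimensional F₀
    (IntermediateField.fixedField
      (Matrix.ProjGenLinGroup.mk.comp (ρ : absoluteGaloisGroup F₀ →* GL (Fin 2) A)).ker :
        IntermediateField F₀ (AlgebraicClosure F₀)) :=
  finiteDimensional_fixedField_of_isOpen _ (isOpen_ker_projective ρ)

omit [IsTopologicalRing A] in
/-- The projective splitting field `F̄₀^H` is Galois over `F₀` (`H` is normal;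
`InfiniteGalois.normal_iff_isGalois`). [folklore] -/
theorem isGalois_fixedField_ker_projective : IsGalois F₀
    (IntermediateField.fixedField
      (Matrix.ProjGenLinGroup.mk.comp (ρ : absoluteGaloisGroup F₀ →* GL (Fin 2) A)).ker :
        IntermediateField F₀ (AlgebraicClosure F₀)) := by
  refine (InfiniteGalois.normal_iff_isGalois _).mp ?_
  rw [fixingSubgroup_fixedField_of_isOpen _ (isOpen_ker_projective ρ)]
  exact MonoidHom.normal_ker _

/-- **Finite projective image: `ρ|_{Γ_{F'}}` is irreducible for `F'` linearly disjoint from the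
projective splitting field.**  Let `H = ker (Γ_{F₀} → PGL₂(A))` (open) and `M = F̄₀^H`.  If
`M ⊗_{F₀} F'` is a field then `M ∩ e(F') = F₀` for the copy `e(F') ⊆ F̄₀` with
`res(Γ_{F'}) = Gal(F̄₀/e(F'))` (`IntermediateField.LinearDisjoint.of_isField'`,
`range_absGaloisRestrict_eq_fixingSubgroup_absEmbedding`), hence `res(Γ_{F'}) · H = Γ_{F₀}`
(Krull: the open subgroup `res(Γ_{F'}) ⊔ H` has fixed field `⊆ M ∩ e(F') = F₀`); as `ρ(H)` is
scalar, a common eigenvector of `ρ(res Γ_{F'})` is one of `ρ(Γ_{F₀})` — but `ρ` is irreducible.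
[folklore] -/
theorem isIrreducible_restrictField_of_isField_tensor_fixedField
    (hirr : ρ.toGaloisRep.IsIrreducible) (F' : Type*) [Field F'] [Algebra F₀ F']
    [Algebra.IsAlgebraic F₀ F']
    (hdisj : IsField ((IntermediateField.fixedField
      (Matrix.ProjGenLinGroup.mk.comp (ρ : absoluteGaloisGroup F₀ →* GL (Fin 2) A)).ker :
        IntermediateField F₀ (AlgebraicClosure F₀)) ⊗[F₀] F')) :
    (ρ.restrictField F').toGaloisRep.IsIrreducible := by
  set H : Subgroup (absoluteGaloisGroup F₀) :=
    (Matrix.ProjGenLinGroup.mk.comp (ρ : absoluteGaloisGroup F₀ →* GL (Fin 2) A)).ker with hH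
  set P : IntermediateField F₀ (AlgebraicClosure F₀) := IntermediateField.fixedField H with hP
  set K' : IntermediateField F₀ (AlgebraicClosure F₀) := (absEmbedding F₀ F').fieldRange with hK'
  -- linear disjointness inside `F̄₀`
  have hPK : P ⊓ K' = ⊥ := by
    simpa only [IntermediateField.fieldRange_val] using
      (IntermediateField.LinearDisjoint.of_isField' hdisj P.val (absEmbedding F₀ F')).inf_eq_bot
  -- `res(Γ_{F'}) ⊔ H = ⊤` by the Galois correspondence for closed subgroups
  set N : Subgroup (absoluteGaloisGroup F₀) := (absGaloisRestrict F₀ F').range with hNdef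
  have hN : N = K'.fixingSubgroup := range_absGaloisRestrict_eq_fixingSubgroup_absEmbedding F₀ F'
  have hNK : IntermediateField.fixedField N ≤ K' :=
    (congrArg IntermediateField.fixedField hN).trans_le
      (InfiniteGalois.fixedField_fixingSubgroup K').le
  have htop : N ⊔ H = ⊤ := by
    set S' : Subgroup (absoluteGaloisGroup F₀) := N ⊔ H with hS'
    have hcl : IsClosed (S' : Set (absoluteGaloisGroup F₀)) :=
      S'.isClosed_of_isOpen (Subgroup.isOpen_mono le_sup_right (isOpen_ker_projective ρ))
    have h1 : IntermediateField.fixedField S' ≤ P ⊓ K' :=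
      le_inf (IntermediateField.fixedField_le le_sup_right)
        ((IntermediateField.fixedField_le le_sup_left).trans hNK)
    have h2 : IntermediateField.fixedField S' = ⊥ := le_bot_iff.mp (hPK ▸ h1)
    have h3 := InfiniteGalois.fixingSubgroup_fixedField ⟨S', hcl⟩
    rw [show ((⟨S', hcl⟩ : ClosedSubgroup (absoluteGaloisGroup F₀)) : Subgroup _) = S' from rfl,
      h2, IntermediateField.fixingSubgroup_bot] at h3
    exact h3.symm
  -- a common eigenvector of `res(Γ_{F'})` is a common eigenvector of `Γ_{F₀}`
  by_contra hred
  obtain ⟨v, hv, hev⟩ := (not_isIrreducible_restrictField_iff ρ).mp hred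
  refine not_hasCommonEigenvector_of_isIrreducible (ρ : absoluteGaloisGroup F₀ →* GL (Fin 2) A)
    hirr ⟨v, hv, fun γ => (mem_eigenvectorStabilizer_iff (hv := hv)).mp ?_⟩
  obtain ⟨n, hn, h, hh, rfl⟩ :=
    Subgroup.mem_sup_of_normal_right.mp (htop.ge (Subgroup.mem_top γ) : γ ∈ N ⊔ H)
  obtain ⟨k, rfl⟩ := hn
  have hh' : (ρ h : GL (Fin 2) A) ∈ Subgroup.center (GL (Fin 2) A) := by
    rw [hH, MonoidHom.mem_ker, MonoidHom.comp_apply, Matrix.ProjGenLinGroup.mk_eq_one] at hh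
    exact hh
  rw [Matrix.GeneralLinearGroup.center_eq_range_scalar] at hh'
  obtain ⟨u, hu⟩ := hh'
  rw [map_mul]
  refine mul_mem (mem_eigenvectorStabilizer_iff.mpr (hev k)) ?_
  rw [MonoidHom.coe_coe, ← hu]
  exact scalar_mem_eigenvectorStabilizer v hv u

end Galois

variable [TopologicalSpace A] [IsTopologicalRing A] [T2Space A]

/-- **Irreducibility is preserved over extensions linearly disjoint from a finite Galois `M/F₀`.**
Let `F₀` be a number field and `ρ : Γ_{F₀} → GL₂(A)` (`A` a Hausdorff topological field) be
irreducible, and irreducible on `Γ_K` for every quadratic extension `K/F₀`.  Then there is a finite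
Galois extension `M/F₀` (`M = F₀` if the projective image of `ρ` is infinite, the projective
splitting field otherwise) such that `ρ|_{Γ_{F'}}` is irreducible for every number field `F' ⊇ F₀`
with `M ⊗_{F₀} F'` a field (i.e. `F'` linearly disjoint from `M` over `F₀`). [folklore] -/
theorem exists_isGalois_forall_isField_tensor_isIrreducible_restrictField {F₀ : Type} [Field F₀]
    [NumberField F₀] (ρ : FramedGaloisRep F₀ A 2) (hirr : ρ.toGaloisRep.IsIrreducible)
    (hnCM : ∀ (K : Type) [Field K] [NumberField K] [Algebra F₀ K], Module.finrank F₀ K = 2 →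
      (ρ.restrictField K).toGaloisRep.IsIrreducible) :
    ∃ (M : Type) (_ : Field M) (_ : NumberField M) (_ : Algebra F₀ M), IsGalois F₀ M ∧
      ∀ (F' : Type) [Field F'] [NumberField F'] [Algebra F₀ F'],
        IsField (M ⊗[F₀] F') → (ρ.restrictField F').toGaloisRep.IsIrreducible := by
  by_cases hfin : Finite (projectiveImage (ρ : absoluteGaloisGroup F₀ →* GL (Fin 2) A))
  · haveI := finiteDimensional_fixedField_ker_projective ρ
    exact ⟨_, inferInstance, NumberField.of_module_finite F₀ _, inferInstance,
      isGalois_fixedField_ker_projective ρ, fun F' _ _ _ hF' =>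
        isIrreducible_restrictField_of_isField_tensor_fixedField ρ hirr F' hF'⟩
  · exact ⟨F₀, inferInstance, inferInstance, inferInstance, inferInstance, fun F' _ _ _ _ =>
      isIrreducible_restrictField_of_infinite_projectiveImage ρ hirr hnCM hfin F'⟩

/-- **Base `ℚ`, the skeleton's shape (registered sub-goal).**  For a Hausdorff topological field
`A` and `ρ : Γ_ℚ → GL₂(A)` irreducible with `∀ K, [K : ℚ] = 2 → ρ|_{Γ_K}` irreducible (`hnCM` of
`DyadicEisensteinFM_of`), there is a finite Galois number field `M/ℚ` with `ρ|_{Γ_{F'}}`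
irreducible for every number field `F'` such that `M ⊗_ℚ F'` is a field (`F'` linearly disjoint
from `M`); `Algebra ℚ _` being a subsingleton, the general statement specialises. [folklore] -/
theorem exists_isGalois_forall_isField_tensor_isIrreducible_restrictField_rat :
    ∀ (A : Type) [Field A] [TopologicalSpace A] [IsTopologicalRing A] [T2Space A]
      (ρ : Literature.NumberTheory.GaloisRepresentations.FramedGaloisRep ℚ A 2),
      ρ.toGaloisRep.IsIrreducible →
      (∀ (K : Type) [Field K] [NumberField K], Module.finrank ℚ K = 2 →
        (ρ.restrictField K).toGaloisRep.IsIrreducible) →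
      ∃ (M : Type) (_ : Field M) (_ : NumberField M), IsGalois ℚ M ∧
        ∀ (F' : Type) [Field F'] [NumberField F'],
          IsField (TensorProduct ℚ M F') → (ρ.restrictField F').toGaloisRep.IsIrreducible := by
  intro A _ _ _ _ ρ hirr hnCM
  have hnCM' : ∀ (K : Type) [Field K] [NumberField K] [Algebra ℚ K], Module.finrank ℚ K = 2 →
      (ρ.restrictField K).toGaloisRep.IsIrreducible := fun K _ _ inst hK => by
    have hinst : inst = DivisionRing.toRatAlgebra := Subsingleton.elim _ _
    subst hinst
    exact hnCM K hK
  obtain ⟨M, _, _, inst, hgal, hM⟩ :=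
    exists_isGalois_forall_isField_tensor_isIrreducible_restrictField ρ hirr hnCM'
  have hinst : inst = DivisionRing.toRatAlgebra := Subsingleton.elim _ _
  subst hinst
  exact ⟨M, inferInstance, inferInstance, hgal, fun F' _ _ hF' => hM F' hF'⟩

end Summit.Langlands.Langlands.Theorems.DyadicEisensteinFM

end
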